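import Summits.RiemannHypothesis.RiemannHypothesis.Theses.WeilComb
import Literature.NumberTheory.LFunctions.WeilExplicit
import Literature.NumberTheory.LFunctions.WeilArchimedeanMoments
import Literature.NumberTheory.LFunctions.WeilMellinBounds
import Literature.NumberTheory.LFunctions.WeilGroundEnergyProofs
import Literature.NumberTheory.LFunctions.LogFreeDensityDirichletSide
import Literature.NumberTheory.LFunctions.MontgomeryOffDiagonalTools
import Mathlib.NumberTheory.Harmonic.Bounds
import Mathlib.Algebra.Order.Chebyshev

/-!
# Stub `stub_core` of line `helson-dirichlet-slack` for crux `WeilComb.CombSubcritical`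
(item stmt-RiemannHypothesis-1025, route route-RiemannHypothesis-WeilComb)

**Statement (the transfer `C⁺`, arithmetic core).** For `a : ℕ → ℂ`, `M ≥ 1`, put
`L = Σ_{m ≤ M} ‖a_m‖²`, `H = 2 Re Σ_m Σ_{n ≤ M/m} Λ(n) n^{-1/2} a(nm) conj(a_m)` (Helson form),
`D = Σ_m Σ_{n ≤ M/m} Λ(n) ‖a(nm) − n^{-1/2} a_m‖² ≥ 0` (Dirichlet energy), `A₋ = Σ ‖a_m‖/√m`,
`A₊ = Σ ‖a_m‖ √m`, `B = Σ_m Σ_{m' ≠ m} ‖a_m‖ ‖a_m'‖ / |log m − log m'|`. Assuming the identity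
`H = Σ_m ‖a_m‖² (log m + ψ₁(M/m)) − D` (`ψ₁(y) = Σ_{n ≤ y} Λ(n)/n`) and the Poincaré inequality
`Σ m log m ‖a_m‖² ≤ 2M·D + C_P·M·L`: for every `C` there is `c₀ ∈ (0, 1/8]` with
`H + (c₀/M)(5 A₋A₊ + 2B + 2(Σ‖a_m‖)²) ≤ (log M + log(1/c₀) − C) L` for all `M ≥ 1`, all `a`.

**Proof.** WLOG `P = max(C_P, 0) ≥ 0`; `c₀ = min(1/32, e^{-K})`, `K = C + log 4 + 20 + 9P`.
(1) `ψ₁(M/m) ≤ log ⌊M/m⌋ + log 4 + 2` (`LogFreeDensity.sum_vonMangoldt_div_le`) and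
`log m + log ⌊M/m⌋ ≤ log M` give `H ≤ (log M + log 4 + 2) L − D`. (2) `(Σ ‖a_m‖)² ≤ M L`.
(3) Schur/AM–GM: `B ≤ Σ_m ‖a_m‖² R_m`, `R_m = Σ_{m' ≠ m} 1/|log m − log m'|`; from
`log x − log y ≥ (x − y)/x` one has `1/|log m − log m'| ≤ m/|m − m'| + 1`, so
`R_m ≤ M + 2m(1 + log M) ≤ 3M + 2 m log m`, and `B ≤ 3ML + 2(2MD + PML)` by Poincaré.
(4) Cauchy–Schwarz twice: `A₋² ≤ L Σ 1/m ≤ L(1 + log M)`, `A₊² ≤ X Σ_{m ≤ M} 1/(1 + log m)`,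
`X = Σ m(1 + log m)‖a_m‖² ≤ ML + 2MD + PML`, and `(1 + log M) Σ_{m ≤ M} 1/(1 + log m) ≤ 4M`
(via `(1 + log M)/(1 + log m) ≤ 2√(M/m)`, `Σ 1/√m ≤ 2√M`); so `A₋A₊ ≤ M((2 + P)L + 2D)`.
(5) Sum: LHS `≤ (log M + log 4 + 2 + c₀(18 + 9P)) L − (1 − 18c₀) D`, and `log(1/c₀) ≥ K`.
-/

noncomputable section

open scoped BigOperators ComplexConjugate
open Complex MeasureTheory Set

namespace Summit.RiemannHypothesis.RiemannHypothesis.Theorems.WeilCombSubcritical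

open Literature.NumberTheory.LFunctions

/-- A map `e : s → {0, …, M}`, injective off `e = 0`, bounds `Σ_{x ∈ s} 1/e(x)` (with `1/0 = 0`)
by the harmonic sum `Σ_{k ≤ M} 1/k ≤ 1 + log M`. -/
private theorem sum_one_div_le_log {s : Finset ℕ} {M : ℕ} (e : ℕ → ℕ)
    (hinj : ∀ x ∈ s, ∀ y ∈ s, e x ≠ 0 → e x = e y → x = y) (hmaps : ∀ x ∈ s, e x ≤ M) :
    ∑ x ∈ s, 1 / ((e x : ℕ) : ℝ) ≤ 1 + Real.log M := by
  have hH := harmonic_le_one_add_log M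
  simp_rw [harmonic_eq_sum_Icc, Rat.cast_sum, Rat.cast_inv, Rat.cast_natCast] at hH
  rw [← Finset.sum_filter_of_ne (p := fun x => e x ≠ 0)
    (fun x _ h h0 => h (by rw [h0, Nat.cast_zero, div_zero]))]
  have hinj' : Set.InjOn e ↑(s.filter fun x => e x ≠ 0) := by
    intro x hx y hy hxy
    simp only [Finset.coe_filter, Set.mem_setOf_eq] at hx hy
    exact hinj x hx.1 y hy.1 hx.2 hxy
  calc ∑ x ∈ s.filter (fun x => e x ≠ 0), 1 / ((e x : ℕ) : ℝ)
      = ∑ k ∈ (s.filter fun x => e x ≠ 0).image e, 1 / (k : ℝ) :=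
        (Finset.sum_image (f := fun k : ℕ => 1 / (k : ℝ)) hinj').symm
    _ ≤ ∑ k ∈ Finset.Icc 1 M, 1 / (k : ℝ) := by
        refine Finset.sum_le_sum_of_subset_of_nonneg (fun k hk => ?_) fun _ _ _ => by positivity
        simp only [Finset.mem_image, Finset.mem_filter] at hk
        obtain ⟨x, ⟨hx, hx0⟩, rfl⟩ := hk
        exact Finset.mem_Icc.mpr ⟨Nat.pos_of_ne_zero hx0, hmaps x hx⟩
    _ ≤ 1 + Real.log M := by simpa only [one_div] using hH

/-- `Σ_{m ≤ M} 1/√m ≤ 2 √M`. -/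
private theorem sum_Icc_inv_sqrt_le (M : ℕ) :
    ∑ m ∈ Finset.Icc 1 M, (Real.sqrt m)⁻¹ ≤ 2 * Real.sqrt M := by
  induction M with
  | zero => simp
  | succ N ih =>
    rw [Finset.sum_Icc_succ_top (Nat.succ_le_succ (Nat.zero_le N))]
    push_cast
    have htpos : 0 < Real.sqrt ((N : ℝ) + 1) := Real.sqrt_pos.mpr (by positivity)
    have key : (Real.sqrt ((N : ℝ) + 1))⁻¹ ≤ 2 * Real.sqrt ((N : ℝ) + 1) - 2 * Real.sqrt N := by
      rw [inv_eq_one_div, div_le_iff₀ htpos]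
      nlinarith [sq_nonneg (Real.sqrt N - Real.sqrt ((N : ℝ) + 1)),
        Real.sq_sqrt (Nat.cast_nonneg (α := ℝ) N),
        Real.sq_sqrt (by positivity : (0 : ℝ) ≤ (N : ℝ) + 1)]
    linarith

/-- `(1 + log M) · Σ_{m ≤ M} 1/(1 + log m) ≤ 4M`, from `(1 + log M)/(1 + log m) ≤ 2 √(M/m)`. -/
private theorem one_add_log_mul_sum_le (M : ℕ) :
    (1 + Real.log M) * ∑ m ∈ Finset.Icc 1 M, (1 + Real.log m)⁻¹ ≤ 4 * M := by
  have key : ∀ m ∈ Finset.Icc 1 M,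
      (1 + Real.log M) * (1 + Real.log m)⁻¹ ≤ 2 * Real.sqrt M * (Real.sqrt m)⁻¹ := by
    intro m hm
    obtain ⟨hm, hmM⟩ := Finset.mem_Icc.mp hm
    have hm0 : (0 : ℝ) < m := by exact_mod_cast hm
    have hM0 : (0 : ℝ) < M := by exact_mod_cast hm.trans hmM
    have hlogm : 0 ≤ Real.log m := Real.log_natCast_nonneg m
    have hℓ : 0 < 1 + Real.log m := by linarith
    have hu0 : 0 ≤ Real.log M - Real.log m :=
      sub_nonneg.mpr (Real.log_le_log hm0 (by exact_mod_cast hmM))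
    have hr : 0 < (M : ℝ) / m := div_pos hM0 hm0
    have hu : Real.log M - Real.log m ≤ 2 * (Real.sqrt M * (Real.sqrt m)⁻¹) - 2 := by
      have h1 := Real.log_le_sub_one_of_pos (Real.sqrt_pos.mpr hr)
      rw [Real.log_sqrt hr.le, Real.log_div hM0.ne' hm0.ne', Real.sqrt_div hM0.le,
        div_eq_mul_inv (Real.sqrt M)] at h1
      linarith
    rw [← div_eq_mul_inv (1 + Real.log M), div_le_iff₀ hℓ]
    nlinarith [mul_nonneg hlogm hu0, mul_le_mul_of_nonneg_left hu hℓ.le]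
  rw [Finset.mul_sum]
  refine (Finset.sum_le_sum key).trans ?_
  rw [← Finset.mul_sum]
  nlinarith [mul_le_mul_of_nonneg_left (sum_Icc_inv_sqrt_le M)
    (by positivity : (0 : ℝ) ≤ 2 * Real.sqrt M), Real.mul_self_sqrt (Nat.cast_nonneg (α := ℝ) M)]

/-- For `x, y > 0`: `(x − y)/x ≤ log x − log y`. -/
private theorem sub_div_le_log_sub_log {x y : ℝ} (hx : 0 < x) (hy : 0 < y) :
    (x - y) / x ≤ Real.log x - Real.log y := by
  have h := Real.log_le_sub_one_of_pos (div_pos hy hx)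
  rw [Real.log_div hy.ne' hx.ne'] at h
  rw [sub_div, div_self hx.ne']
  linarith

/-- For distinct positive integers: `1/|log m − log m'| ≤ m/|m − m'| + 1`. -/
private theorem inv_abs_log_sub_le {m m' : ℕ} (hm : 1 ≤ m) (hm' : 1 ≤ m') (hne : m ≠ m') :
    1 / |Real.log m - Real.log m'| ≤ (m : ℝ) / |(m : ℝ) - m'| + 1 := by
  have hm0 : (0 : ℝ) < m := by exact_mod_cast hm
  have hm0' : (0 : ℝ) < m' := by exact_mod_cast hm'
  rcases lt_or_gt_of_ne hne with h | h
  · have hlt : (m : ℝ) < m' := by exact_mod_cast h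
    have h1 := sub_div_le_log_sub_log hm0' hm0
    have hδ : 0 < ((m' : ℝ) - m) / m' := div_pos (by linarith) hm0'
    have hne' : (m' : ℝ) - m ≠ 0 := (sub_pos.mpr hlt).ne'
    rw [abs_sub_comm (Real.log m) (Real.log m'), abs_sub_comm (m : ℝ) (m' : ℝ),
      abs_of_pos (sub_pos.mpr hlt), abs_of_pos (hδ.trans_le h1)]
    calc 1 / (Real.log m' - Real.log m) ≤ 1 / (((m' : ℝ) - m) / m') :=
          one_div_le_one_div_of_le hδ h1
      _ = (m : ℝ) / ((m' : ℝ) - m) + 1 := by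
          rw [one_div_div]
          field_simp
          ring
  · have hlt : (m' : ℝ) < m := by exact_mod_cast h
    have h1 := sub_div_le_log_sub_log hm0 hm0'
    have hδ : 0 < ((m : ℝ) - m') / m := div_pos (by linarith) hm0
    rw [abs_of_pos (sub_pos.mpr hlt), abs_of_pos (hδ.trans_le h1)]
    calc 1 / (Real.log m - Real.log m') ≤ 1 / (((m : ℝ) - m') / m) :=
          one_div_le_one_div_of_le hδ h1
      _ = (m : ℝ) / ((m : ℝ) - m') := one_div_div _ _
      _ ≤ (m : ℝ) / ((m : ℝ) - m') + 1 := by linarith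

/-- `Σ_{m' ≤ M, m' ≠ m} 1/|m − m'| ≤ 2 (1 + log M)` for `m ≤ M` (two harmonic sums). -/
private theorem sum_erase_inv_abs_sub_le {M m : ℕ} (hmM : m ≤ M) :
    ∑ m' ∈ (Finset.Icc 1 M).erase m, 1 / |(m : ℝ) - m'| ≤ 2 * (1 + Real.log M) := by
  -- `1/|m - m'| = 1/(m - m' : ℕ) + 1/(m' - m : ℕ)` (one of the two is `1/0 = 0`)
  have hsplit : ∀ m' : ℕ,
      1 / |(m : ℝ) - m'| = 1 / ((m - m' : ℕ) : ℝ) + 1 / ((m' - m : ℕ) : ℝ) := by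
    intro m'
    rcases le_or_gt m m' with h | h
    · rw [Nat.sub_eq_zero_of_le h, Nat.cast_zero, div_zero, zero_add, Nat.cast_sub h,
        abs_sub_comm, abs_of_nonneg (sub_nonneg.mpr (by exact_mod_cast h))]
    · rw [Nat.sub_eq_zero_of_le h.le, Nat.cast_zero, div_zero, add_zero, Nat.cast_sub h.le,
        abs_of_nonneg (sub_nonneg.mpr (by exact_mod_cast h.le))]
  simp_rw [hsplit, Finset.sum_add_distrib, two_mul]
  exact add_le_add
    (sum_one_div_le_log (fun m' => m - m') (fun x _ y _ h0 h => by omega) fun x _ => by omega)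
    (sum_one_div_le_log (fun m' => m' - m) (fun x _ y _ h0 h => by omega) fun x hx =>
      (Nat.sub_le x m).trans (Finset.mem_Icc.mp (Finset.mem_of_mem_erase hx)).2)

/-- Row sums of the kernel: `Σ_{m' ≠ m} 1/|log m − log m'| ≤ 3M + 2 m log m` for `m ∈ Icc 1 M`. -/
private theorem rowsum_le {M m : ℕ} (hm : m ∈ Finset.Icc 1 M) :
    ∑ m' ∈ (Finset.Icc 1 M).erase m, 1 / |Real.log m - Real.log m'| ≤
      3 * M + 2 * ((m : ℝ) * Real.log m) := by
  obtain ⟨hm1, hmM⟩ := Finset.mem_Icc.mp hm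
  have hm0 : (0 : ℝ) < m := by exact_mod_cast hm1
  have hM0 : (0 : ℝ) < M := by exact_mod_cast hm1.trans hmM
  calc ∑ m' ∈ (Finset.Icc 1 M).erase m, 1 / |Real.log m - Real.log m'|
      ≤ ∑ m' ∈ (Finset.Icc 1 M).erase m, ((m : ℝ) * (1 / |(m : ℝ) - m'|) + 1) := by
        refine Finset.sum_le_sum fun m' hm' => ?_
        obtain ⟨hne, hm'⟩ := Finset.mem_erase.mp hm'
        rw [mul_one_div]
        exact inv_abs_log_sub_le hm1 (Finset.mem_Icc.mp hm').1 hne.symm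
    _ = (m : ℝ) * ∑ m' ∈ (Finset.Icc 1 M).erase m, 1 / |(m : ℝ) - m'| +
          ((Finset.Icc 1 M).erase m).card := by
        rw [Finset.sum_add_distrib, Finset.mul_sum, Finset.sum_const, nsmul_eq_mul, mul_one]
    _ ≤ (m : ℝ) * (2 * (1 + Real.log M)) + M := by
        have hcard : (((Finset.Icc 1 M).erase m).card : ℝ) ≤ M := by
          have h := Finset.card_erase_le (s := Finset.Icc 1 M) (a := m)
          rw [Nat.card_Icc] at h
          exact_mod_cast h.trans (by omega)
        linarith [mul_le_mul_of_nonneg_left (sum_erase_inv_abs_sub_le hmM) hm0.le]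
    _ ≤ 3 * M + 2 * ((m : ℝ) * Real.log m) := by
        -- `m (log M - log m) ≤ M - m`
        have h := sub_div_le_log_sub_log hm0 hM0
        rw [div_le_iff₀ hm0] at h
        nlinarith [h]

/-- Helson side: `Σ_m ‖a_m‖² (log m + ψ₁(M/m)) ≤ (log M + log 4 + 2) ‖a‖²`. -/
private theorem helson_le (M : ℕ) (a : ℕ → ℂ) :
    ∑ m ∈ Finset.Icc 1 M, ‖a m‖ ^ 2 *
        (Real.log m + ∑ n ∈ Finset.Icc 1 (M / m), (ArithmeticFunction.vonMangoldt n : ℝ) / n) ≤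
      (Real.log M + Real.log 4 + 2) * ∑ m ∈ Finset.Icc 1 M, ‖a m‖ ^ 2 := by
  rw [Finset.mul_sum]
  refine Finset.sum_le_sum fun m hm => ?_
  obtain ⟨hm1, hmM⟩ := Finset.mem_Icc.mp hm
  have hm0 : (0 : ℝ) < m := by exact_mod_cast hm1
  have hq0 : (0 : ℝ) < ((M / m : ℕ) : ℝ) := by exact_mod_cast Nat.div_pos hmM hm1
  have hψ := LogFreeDensity.sum_vonMangoldt_div_le (M / m)
  have hdiv : (m : ℝ) * ((M / m : ℕ) : ℝ) ≤ M := by exact_mod_cast Nat.mul_div_le M m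
  have hlog : Real.log m + Real.log ((M / m : ℕ) : ℝ) ≤ Real.log M := by
    rw [← Real.log_mul hm0.ne' hq0.ne']
    exact Real.log_le_log (mul_pos hm0 hq0) hdiv
  rw [mul_comm]
  exact mul_le_mul_of_nonneg_right (by linarith) (sq_nonneg _)

/-- Off-diagonal term (Schur test with AM–GM and the row-sum bound):
`B ≤ Σ_m ‖a_m‖² R_m ≤ 3M ‖a‖² + 2 Σ_m m log m ‖a_m‖²`. -/
private theorem offdiag_le (M : ℕ) (a : ℕ → ℂ) :
    ∑ m ∈ Finset.Icc 1 M, ∑ m' ∈ (Finset.Icc 1 M).erase m,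
        ‖a m‖ * ‖a m'‖ / |Real.log m - Real.log m'| ≤
      3 * M * (∑ m ∈ Finset.Icc 1 M, ‖a m‖ ^ 2) +
        2 * ∑ m ∈ Finset.Icc 1 M, (m : ℝ) * Real.log m * ‖a m‖ ^ 2 := by
  set S := Finset.Icc 1 M with hS
  -- symmetry of the off-diagonal index set and of the kernel
  have hsymm : ∑ m ∈ S, ∑ m' ∈ S.erase m, ‖a m'‖ ^ 2 / |Real.log m - Real.log m'| =
      ∑ m ∈ S, ∑ m' ∈ S.erase m, ‖a m‖ ^ 2 / |Real.log m - Real.log m'| := by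
    rw [Finset.sum_comm' (t' := S) (s' := fun m' => S.erase m')]
    · refine Finset.sum_congr rfl fun m _ => Finset.sum_congr rfl fun m' _ => ?_
      rw [abs_sub_comm]
    · intro m m'
      simp only [Finset.mem_erase]
      exact ⟨fun ⟨h1, h2, h3⟩ => ⟨⟨fun h => h2 h.symm, h1⟩, h3⟩,
        fun ⟨⟨h1, h2⟩, h3⟩ => ⟨h2, fun h => h1 h.symm, h3⟩⟩
  calc ∑ m ∈ S, ∑ m' ∈ S.erase m, ‖a m‖ * ‖a m'‖ / |Real.log m - Real.log m'|
      ≤ ∑ m ∈ S, ∑ m' ∈ S.erase m, (‖a m‖ ^ 2 / |Real.log m - Real.log m'| / 2 +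
          ‖a m'‖ ^ 2 / |Real.log m - Real.log m'| / 2) := by
        refine Finset.sum_le_sum fun m _ => Finset.sum_le_sum fun m' _ => ?_
        have ht : 0 ≤ (|Real.log m - Real.log m'|)⁻¹ := inv_nonneg.mpr (abs_nonneg _)
        simp only [div_eq_mul_inv]
        nlinarith [mul_nonneg ht (sq_nonneg (‖a m‖ - ‖a m'‖))]
    _ = ∑ m ∈ S, ∑ m' ∈ S.erase m, ‖a m‖ ^ 2 / |Real.log m - Real.log m'| := by
        simp only [Finset.sum_add_distrib, ← Finset.sum_div, hsymm]
        ring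
    _ = ∑ m ∈ S, ‖a m‖ ^ 2 * ∑ m' ∈ S.erase m, 1 / |Real.log m - Real.log m'| := by
        refine Finset.sum_congr rfl fun m _ => ?_
        rw [Finset.mul_sum]
        exact Finset.sum_congr rfl fun m' _ => by rw [mul_one_div]
    _ ≤ ∑ m ∈ S, ‖a m‖ ^ 2 * (3 * M + 2 * ((m : ℝ) * Real.log m)) :=
        Finset.sum_le_sum fun m hm => mul_le_mul_of_nonneg_left (rowsum_le hm) (sq_nonneg _)
    _ = 3 * M * (∑ m ∈ S, ‖a m‖ ^ 2) + 2 * ∑ m ∈ S, (m : ℝ) * Real.log m * ‖a m‖ ^ 2 := by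
        rw [Finset.mul_sum, Finset.mul_sum, ← Finset.sum_add_distrib]
        exact Finset.sum_congr rfl fun m _ => by ring

/-- Pole shadow (Cauchy–Schwarz twice): `(A₋ A₊)² ≤ 4M ‖a‖² (M ‖a‖² + Σ_m m log m ‖a_m‖²)`. -/
private theorem polar_sq_le (M : ℕ) (a : ℕ → ℂ) :
    ((∑ m ∈ Finset.Icc 1 M, ‖a m‖ / Real.sqrt m) *
        (∑ m ∈ Finset.Icc 1 M, ‖a m‖ * Real.sqrt m)) ^ 2 ≤
      4 * M * (∑ m ∈ Finset.Icc 1 M, ‖a m‖ ^ 2) *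
        (M * (∑ m ∈ Finset.Icc 1 M, ‖a m‖ ^ 2) +
          ∑ m ∈ Finset.Icc 1 M, (m : ℝ) * Real.log m * ‖a m‖ ^ 2) := by
  have hℓ : ∀ m : ℕ, 0 < 1 + Real.log m := fun m => by positivity
  -- Cauchy–Schwarz for `A₋`
  have hAm : (∑ m ∈ Finset.Icc 1 M, ‖a m‖ / Real.sqrt m) ^ 2 ≤
      (∑ m ∈ Finset.Icc 1 M, ‖a m‖ ^ 2) * ∑ m ∈ Finset.Icc 1 M, 1 / ((id m : ℕ) : ℝ) := by
    calc (∑ m ∈ Finset.Icc 1 M, ‖a m‖ / Real.sqrt m) ^ 2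
        = (∑ m ∈ Finset.Icc 1 M, ‖a m‖ * (Real.sqrt m)⁻¹) ^ 2 := by simp_rw [div_eq_mul_inv]
      _ ≤ (∑ m ∈ Finset.Icc 1 M, ‖a m‖ ^ 2) * ∑ m ∈ Finset.Icc 1 M, ((Real.sqrt m)⁻¹) ^ 2 :=
          Finset.sum_mul_sq_le_sq_mul_sq _ _ _
      _ = (∑ m ∈ Finset.Icc 1 M, ‖a m‖ ^ 2) * ∑ m ∈ Finset.Icc 1 M, 1 / ((id m : ℕ) : ℝ) := by
          congr 1
          refine Finset.sum_congr rfl fun m _ => ?_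
          rw [inv_pow, Real.sq_sqrt (Nat.cast_nonneg _), id, one_div]
  -- Cauchy–Schwarz for `A₊`
  have hAp : (∑ m ∈ Finset.Icc 1 M, ‖a m‖ * Real.sqrt m) ^ 2 ≤
      (∑ m ∈ Finset.Icc 1 M, (m : ℝ) * (1 + Real.log m) * ‖a m‖ ^ 2) *
        ∑ m ∈ Finset.Icc 1 M, (1 + Real.log m)⁻¹ := by
    calc (∑ m ∈ Finset.Icc 1 M, ‖a m‖ * Real.sqrt m) ^ 2
        = (∑ m ∈ Finset.Icc 1 M, (‖a m‖ * Real.sqrt m * Real.sqrt (1 + Real.log m)) *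
            (Real.sqrt (1 + Real.log m))⁻¹) ^ 2 := by
          congr 1
          refine Finset.sum_congr rfl fun m _ => ?_
          rw [mul_inv_cancel_right₀ (Real.sqrt_pos.mpr (hℓ m)).ne']
      _ ≤ (∑ m ∈ Finset.Icc 1 M, (‖a m‖ * Real.sqrt m * Real.sqrt (1 + Real.log m)) ^ 2) *
            ∑ m ∈ Finset.Icc 1 M, ((Real.sqrt (1 + Real.log m))⁻¹) ^ 2 :=
          Finset.sum_mul_sq_le_sq_mul_sq _ _ _
      _ = (∑ m ∈ Finset.Icc 1 M, (m : ℝ) * (1 + Real.log m) * ‖a m‖ ^ 2) *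
            ∑ m ∈ Finset.Icc 1 M, (1 + Real.log m)⁻¹ := by
          congr 1
          · refine Finset.sum_congr rfl fun m _ => ?_
            rw [mul_pow, mul_pow, Real.sq_sqrt (Nat.cast_nonneg _), Real.sq_sqrt (hℓ m).le]
            ring
          · refine Finset.sum_congr rfl fun m _ => ?_
            rw [inv_pow, Real.sq_sqrt (hℓ m).le]
  -- `X ≤ M ‖a‖² + Σ m log m ‖a_m‖²`
  have hX : ∑ m ∈ Finset.Icc 1 M, (m : ℝ) * (1 + Real.log m) * ‖a m‖ ^ 2 ≤
      M * (∑ m ∈ Finset.Icc 1 M, ‖a m‖ ^ 2) +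
        ∑ m ∈ Finset.Icc 1 M, (m : ℝ) * Real.log m * ‖a m‖ ^ 2 := by
    rw [Finset.mul_sum, ← Finset.sum_add_distrib]
    refine Finset.sum_le_sum fun m hm => ?_
    have h : (m : ℝ) ≤ M := by exact_mod_cast (Finset.mem_Icc.mp hm).2
    nlinarith [mul_le_mul_of_nonneg_right h (sq_nonneg ‖a m‖)]
  have hH : ∑ m ∈ Finset.Icc 1 M, 1 / ((id m : ℕ) : ℝ) ≤ 1 + Real.log M :=
    sum_one_div_le_log id (fun _ _ _ _ _ h => h) fun m hm => (Finset.mem_Icc.mp hm).2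
  have hG := one_add_log_mul_sum_le M
  have hL0 : 0 ≤ ∑ m ∈ Finset.Icc 1 M, ‖a m‖ ^ 2 := by positivity
  have hX0 : 0 ≤ ∑ m ∈ Finset.Icc 1 M, (m : ℝ) * (1 + Real.log m) * ‖a m‖ ^ 2 := by positivity
  have hG0 : 0 ≤ ∑ m ∈ Finset.Icc 1 M, (1 + Real.log (m : ℝ))⁻¹ := by positivity
  have hH0 : 0 ≤ ∑ m ∈ Finset.Icc 1 M, 1 / ((id m : ℕ) : ℝ) := by positivity
  set L := ∑ m ∈ Finset.Icc 1 M, ‖a m‖ ^ 2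
  set X := ∑ m ∈ Finset.Icc 1 M, (m : ℝ) * (1 + Real.log m) * ‖a m‖ ^ 2
  set G := ∑ m ∈ Finset.Icc 1 M, (1 + Real.log (m : ℝ))⁻¹
  set HM := ∑ m ∈ Finset.Icc 1 M, 1 / ((id m : ℕ) : ℝ)
  rw [mul_pow]
  calc _ ≤ (L * HM) * (X * G) := mul_le_mul hAm hAp (sq_nonneg _) (mul_nonneg hL0 hH0)
    _ = L * X * (HM * G) := by ring
    _ ≤ L * X * ((1 + Real.log M) * G) :=
        mul_le_mul_of_nonneg_left (mul_le_mul_of_nonneg_right hH hG0) (mul_nonneg hL0 hX0)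
    _ ≤ L * X * (4 * M) := mul_le_mul_of_nonneg_left hG (mul_nonneg hL0 hX0)
    _ = 4 * M * L * X := by ring
    _ ≤ _ := mul_le_mul_of_nonneg_left hX (by positivity)

/-- Pure real-arithmetic assembly of the four pieces. -/
private theorem assemble {C C' P c₀ M L D T Am Ap B S Q lM li : ℝ} (hP0 : 0 ≤ P) (hPle : C' ≤ P)
    (hc0 : 0 < c₀) (hc32 : c₀ ≤ 1 / 32) (hli : C + Real.log 4 + 20 + 9 * P ≤ li) (hM : 0 < M)
    (hL : 0 ≤ L) (hD : 0 ≤ D) (hT : T ≤ (lM + Real.log 4 + 2) * L) (hS : S ^ 2 ≤ M * L)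
    (hB : B ≤ 3 * M * L + 2 * Q) (hQ : Q ≤ 2 * M * D + C' * M * L)
    (hA2 : (Am * Ap) ^ 2 ≤ 4 * M * L * (M * L + Q)) (hAnn : 0 ≤ Am * Ap) :
    T - D + c₀ / M * (5 * Am * Ap + 2 * B + 2 * S ^ 2) ≤ (lM + li - C) * L := by
  have hQ' : Q ≤ 2 * M * D + P * M * L := by
    nlinarith [mul_le_mul_of_nonneg_right hPle (mul_nonneg hM.le hL)]
  have hY0 : 0 ≤ (2 + P) * L + 2 * D := by positivity
  -- pole shadow: `A₋ A₊ ≤ M ((2 + P) L + 2 D)`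
  have hA : Am * Ap ≤ M * ((2 + P) * L + 2 * D) := by
    refine (sq_le_sq₀ hAnn (mul_nonneg hM.le hY0)).1 ?_
    calc (Am * Ap) ^ 2 ≤ 4 * M * L * (M * L + Q) := hA2
      _ ≤ 4 * M * L * (M * L + (2 * M * D + P * M * L)) :=
          mul_le_mul_of_nonneg_left (by linarith) (by positivity)
      _ ≤ (M * ((2 + P) * L + 2 * D)) ^ 2 := by
          nlinarith [sq_nonneg (M * (L - ((1 + P) * L + 2 * D)))]
  have hZ : 5 * Am * Ap + 2 * B + 2 * S ^ 2 ≤ M * ((18 + 9 * P) * L + 18 * D) := by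
    nlinarith [hA, hB, hQ', hS]
  have hcZ : c₀ / M * (5 * Am * Ap + 2 * B + 2 * S ^ 2) ≤ c₀ * ((18 + 9 * P) * L + 18 * D) := by
    calc c₀ / M * (5 * Am * Ap + 2 * B + 2 * S ^ 2)
        ≤ c₀ / M * (M * ((18 + 9 * P) * L + 18 * D)) :=
          mul_le_mul_of_nonneg_left hZ (div_nonneg hc0.le hM.le)
      _ = c₀ * ((18 + 9 * P) * L + 18 * D) := by
          field_simp
  have h1 : c₀ * ((18 + 9 * P) * L) ≤ 1 * ((18 + 9 * P) * L) :=
    mul_le_mul_of_nonneg_right (by linarith) (by positivity)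
  have h2 : c₀ * (18 * D) ≤ 1 / 32 * (18 * D) := mul_le_mul_of_nonneg_right hc32 (by positivity)
  have h3 : (C + Real.log 4 + 20 + 9 * P) * L ≤ li * L := mul_le_mul_of_nonneg_right hli hL
  nlinarith [hT, hcZ, h1, h2, h3, hD, hL]

/-- **Stub 3 — the transfer `C⁺` (arithmetic core).** From the identity and the Poincaré
inequality: `∀ C ∃ c₀ ∈ (0, 1/8] ∀ M ≥ 1 ∀ a,
⟨S_M a,a⟩ + (c₀/M)·archShadow(a) ≤ (log M + log(1/c₀) − C) ‖a‖²`. -/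
theorem stub_core :
    (∀ (M : ℕ) (a : ℕ → ℂ),
      2 * (∑ m ∈ Finset.Icc 1 M, ∑ n ∈ Finset.Icc 1 (M / m),
          ((ArithmeticFunction.vonMangoldt n : ℝ) : ℂ) / (Real.sqrt n : ℂ) * a (n * m) *
            conj (a m)).re =
        (∑ m ∈ Finset.Icc 1 M, ‖a m‖ ^ 2 *
            (Real.log m + ∑ n ∈ Finset.Icc 1 (M / m),
              (ArithmeticFunction.vonMangoldt n : ℝ) / n)) -
          ∑ m ∈ Finset.Icc 1 M, ∑ n ∈ Finset.Icc 1 (M / m),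
            (ArithmeticFunction.vonMangoldt n : ℝ) * ‖a (n * m) - ((Real.sqrt n : ℂ))⁻¹ * a m‖ ^ 2) →
    (∃ C : ℝ, ∀ (M : ℕ) (a : ℕ → ℂ),
      ∑ m ∈ Finset.Icc 1 M, (m : ℝ) * Real.log m * ‖a m‖ ^ 2 ≤
        2 * M * (∑ m ∈ Finset.Icc 1 M, ∑ n ∈ Finset.Icc 1 (M / m),
            (ArithmeticFunction.vonMangoldt n : ℝ) * ‖a (n * m) - ((Real.sqrt n : ℂ))⁻¹ * a m‖ ^ 2) +
          C * M * ∑ m ∈ Finset.Icc 1 M, ‖a m‖ ^ 2) →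
    ∀ C : ℝ, ∃ c₀ : ℝ, 0 < c₀ ∧ c₀ ≤ 1 / 8 ∧ ∀ (M : ℕ) (a : ℕ → ℂ), 1 ≤ M →
      2 * (∑ m ∈ Finset.Icc 1 M, ∑ n ∈ Finset.Icc 1 (M / m),
          ((ArithmeticFunction.vonMangoldt n : ℝ) : ℂ) / (Real.sqrt n : ℂ) * a (n * m) *
            conj (a m)).re +
        c₀ / M * (5 * (∑ m ∈ Finset.Icc 1 M, ‖a m‖ / Real.sqrt m) *
              (∑ m ∈ Finset.Icc 1 M, ‖a m‖ * Real.sqrt m) +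
            2 * (∑ m ∈ Finset.Icc 1 M, ∑ m' ∈ (Finset.Icc 1 M).erase m,
              ‖a m‖ * ‖a m'‖ / |Real.log m - Real.log m'|) +
            2 * (∑ m ∈ Finset.Icc 1 M, ‖a m‖) ^ 2) ≤
      (Real.log M + Real.log (1 / c₀) - C) * ∑ m ∈ Finset.Icc 1 M, ‖a m‖ ^ 2 := by
  intro hI hP C
  obtain ⟨C_P, hP⟩ := hP
  -- WLOG the Poincaré constant is nonnegative.
  obtain ⟨P, hP0, hPle⟩ : ∃ P : ℝ, 0 ≤ P ∧ C_P ≤ P := ⟨max C_P 0, le_max_right _ _, le_max_left _ _⟩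
  obtain ⟨K, hK⟩ : ∃ K : ℝ, K = C + Real.log 4 + 20 + 9 * P := ⟨_, rfl⟩
  have hc0 : 0 < min (1 / 32) (Real.exp (-K)) := lt_min (by norm_num) (Real.exp_pos _)
  refine ⟨min (1 / 32) (Real.exp (-K)), hc0, (min_le_left _ _).trans (by norm_num), ?_⟩
  have hli : C + Real.log 4 + 20 + 9 * P ≤ Real.log (1 / min (1 / 32) (Real.exp (-K))) := by
    rw [one_div, Real.log_inv, ← hK]
    have h := Real.log_le_log hc0 (min_le_right _ _)
    rw [Real.log_exp] at h
    linarith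
  intro M a hM
  have hM0 : (0 : ℝ) < M := by exact_mod_cast hM
  have hS := sq_sum_le_card_mul_sum_sq (s := Finset.Icc 1 M) (f := fun m => ‖a m‖)
  rw [Nat.card_Icc, Nat.add_sub_cancel] at hS
  rw [hI M a]
  exact assemble hP0 hPle hc0 (min_le_left _ _) hli hM0 (by positivity) (by positivity)
    (helson_le M a) hS (offdiag_le M a) (hP M a) (polar_sq_le M a) (by positivity)

end Summit.RiemannHypothesis.RiemannHypothesis.Theorems.WeilCombSubcritical

end
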